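import Summits.Ventures.QEC.Thresholds.RotatedSurfaceCodeSAWThresholds
import Summits.Ventures.QEC.Thresholds.PlanarSurfaceCodePhenomSAWThresholds
import Literature.InformationTheory.QuantumCodes.RotatedSurfaceCodeDrawing
import HarnessLib

/-!
# Rotated surface codes `RSC(L) = [[L², 1, L]]` with NOISY syndrome measurement (`q = p`, polynomially many rounds), `H_X`
# sector: the space-time SAW-counting threshold `p₀(μ(ℤ³)) > .0112` for every minimum-weight / space-time-MWPM decoder family —
# unconditional, tier CERTIFIED (kernel)

Venture QEC, `Summits/Ventures/QEC/Thresholds/` (LADDER-QEC rung Q5, PARTITION row 09 "phenomenological"; qec-type-09 gen 7, cell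
item «09.RSCPH»). Item 143 (`RotatedSurfaceCodeThresholds.lean`) certifies the `T`-round memory experiment of the rotated
surface codes (`zPhenomFailureFamily rscCode T D`: lit-2's generic space-time model `CSSPhenom` with `H = HX (i+1)`, `q = p`)
at the cluster-expansion value `p₀(5) ≈ .0101` (`rsc_z_phenom_isThresholdLowerBound`), while the toric and planar codes stand at
the space-time SAW value `p₀(4.7476) > .0112`. The Literature files of this item prove Dennis–Kitaev–Landahl–Preskill's
space-time relative-polygon bound ONCE for every check matrix drawn on `ℤ^d` (`DrawnCheckMatrixCrossingPaths.lean`,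
`DrawnCheckMatrixCountingBound.lean`, `DrawnCheckMatrixSpaceTime.lean`) and instantiate it for the `H_X` sector of `RSC(L)`
drawn on the diagonal square lattice (`RotatedSurfaceCodeDrawing.lean`: `Prob ≤ L·T·C·r^L/(1-r)` under `cₙ(ℤ³) ≤ C νⁿ`,
`r = 2ν√(p(1-p))`). This file packages the consequences:

| theorem | statement | tier |
|---|---|---|
| `rsc_phenom_oddResidual_of_not_corrects`, `rsc_zPhenomFailureFamily_le_of_sawCountBound3` | failure of the memory experiment ⇒ the residual history projects to a chain with an odd number of column-`0` qubits (one logical qubit, `rsc_colZero_eq_one`); finite-size bound `P_fail(i) ≤ (i+1)·T(i)·C·r^{i+1}/(1-r)` | CERTIFIED (kernel) |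
| `rsc_z_phenom_isThresholdLowerBound_of_sawCountBound3`, `…_of_connectiveConstant_three_le` | `cₙ(ℤ³) ≤ C νⁿ ⇒ p_c ≥ p₀(ν)`; `μ(ℤ³) ≤ μ' ⇒ p_c ≥ p₀(μ')` — every polynomially bounded schedule, every minimum-weight space-time decoder family of the `H_X` sector | CERTIFIED (kernel), parametric |
| ★ `rsc_z_phenom_isThresholdLowerBound_kernelZ3SymmK12`, ★ `rsc_z_phenom_accuracyThreshold_gt_0112`, `rsc_z_phenom_accuracyThreshold_stMinWeight_gt_0112`, `rsc_z_phenom_decaysExponentially_0112` | **`p_c^phenom(RSC, H_X sector) > .0112`** at the kernel certificate `μ(ℤ³) ≤ 4.7476` (was `.0101`), every polynomially bounded schedule and minimum-weight space-time decoder family; exponential decay for `p ≤ .0112` | CERTIFIED (kernel), unconditional |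
| `rsc_z_phenom_mwpm_isThresholdLowerBound_kernelZ3SymmK12`, `rsc_z_phenom_mwpm_accuracyThreshold_gt_0112` | the same for EVERY space-time boundary-MWPM family (defects = syndrome changes matched in the space-time graph with the rough edge as boundary) | CERTIFIED (kernel), unconditional |

HONEST FRAMING. The `H_X` sector (`Z` errors, noisy `X`-syndrome); the `H_Z` sector needs the second drawing (`RotatedSurfaceCodeLiftZ`)
and is item 143's `.0101` until then. Certified LOWER bounds, one error type at a time (`q = p`); decimals are kernel consequences of
the memory-12 certificate `μ(ℤ³) ≤ 4.7476` (`SAW.Zd.FiniteMemory3.connectiveConstant_three_le_47476`). NOT asserted: DKLP's printed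
`p, q < .0114` (numerical `μ₃`, CLAIM), the numerical `p_{c0} = .0293 ± .0002` (Wang–Harrington–Preskill 2003), and any circuit-level
number for Surface-17/49/97. No `native_decide`, no named fact.

## References

* [DennisEtAl2002] E. Dennis, A. Kitaev, A. Landahl, J. Preskill, *Topological quantum memory*, J. Math. Phys. 43 (2002)
  4452–4505, arXiv:quant-ph/0110143, §4.2–4.3 (space-time lattice, syndrome = boundary), §5.1 (E_min on the space-time
  lattice), §5.2–5.3 (eqs. (e_ineq), (saw_L), (saw_3), (threshold_iso), (fail_iso), (threshold_iso_num); "To bound the failure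
  probability for a planar code … relative polygons … This change has no effect on the estimate of the threshold").
* [TomitaSvore2014] Y. Tomita, K. M. Svore, PRA 90 (2014) 062320, §2.2 (Surface-17, the rotated layout).
* [WangHarringtonPreskill2003] C. Wang, J. Harrington, J. Preskill, Ann. Phys. 303 (2003) 31–58, abstract (`p_{c0} = .0293`).
* [PonitzTittmann2000] Electron. J. Combin. 7 (2000) R21, Table 2 (`d = 3, k = 12`); [LinPryadko2024] PRA 109 (2024) 022407, §4.2 Thm 6.
-/

noncomputable section

namespace Summit.Ventures.QEC.Thresholds

open Filter Topology Finset Matrix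
open Literature.InformationTheory.QuantumCodes
open Literature.InformationTheory.QuantumCodes.RotatedSurface
open Literature.InformationTheory.QuantumCodes.ToricCode (SAWCountBound3 IsPolyBounded)
open Literature.Probability.RandomPlanarGeometry

/-! ### Failure leaves an odd column-`0` projected residual; the finite-size bound -/

/-- **Failure of the memory experiment ⇒ odd column-`0` projected residual.** If a minimum-weight space-time decoder `D` of
the `T`-round experiment of the `H_X` sector of `RSC(L)` (`L ≥ 1`) fails on the history `E` (the net residual `Π(D(∂E) + E)`
is a NON-TRIVIAL `Z`-logical), the projection of the residual has an odd number of qubits in column `0` (`Π` of a space-time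
cycle is undetectable, `CSSPhenom.mulVec_proj_eq_zero`; one encoded qubit, `rsc_colZero_eq_one`).
[cite: DennisEtAl2002, §4.3 (success iff the residual is homologically trivial) and §6.1 (the projection Π)] -/
theorem rsc_phenom_oddResidual_of_not_corrects {L : ℕ} (hL : 0 < L) (T : ℕ)
    {D : CSSPhenom.STDecoder (Fin (L + 1) × Fin (L - 1)) (Fin L × Fin L) T}
    (hD : D.IsMinWeight (CSSPhenom.stSyn (HX L) T) (CSSPhenom.stCycles (HX L) T) hammingNorm)
    {E : CSSPhenom.History (Fin (L + 1) × Fin (L - 1)) (Fin L × Fin L) T}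
    (hfail : ¬ D.Corrects (CSSPhenom.stSyn (HX L) T)
      (CSSPhenom.stTrivial ((RotatedSurface.code L).rowSpZ : Set (Fin L × Fin L → ZMod 2)) T) E) :
    ∑ i : Fin L, CSSPhenom.proj (D (CSSPhenom.stSyn (HX L) T E) + E) (i, ⟨0, hL⟩) = 1 := by
  have hc : CSSPhenom.stMatrix (HX L) T *ᵥ (D (CSSPhenom.stSyn (HX L) T E) + E) = 0 := hD.add_mem E
  exact rsc_colZero_eq_one hL (CSSPhenom.mulVec_proj_eq_zero hc) hfail

open Classical in
/-- The failure probability of the memory experiment is at most the probability of an odd column-`0` projected residual.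
[cite: DennisEtAl2002, §5.2 (Prob_fail ≤ the probability of a non-trivial (relative) space-time polygon)] -/
theorem rsc_zPhenomFailureFamily_le_sum_oddResidual (T : ℕ → ℕ)
    (D : ∀ i, CSSPhenom.STDecoder (Fin (i + 1 + 1) × Fin (i + 1 - 1)) (Fin (i + 1) × Fin (i + 1)) (T i))
    (hD : ∀ i, (D i).IsMinWeight (CSSPhenom.stSyn (rscCode i).HX (T i)) (CSSPhenom.stCycles (rscCode i).HX (T i))
      hammingNorm)
    (i : ℕ) {p : ℝ} (hp0 : 0 ≤ p) (hp1 : p ≤ 1) :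
    zPhenomFailureFamily rscCode T D i p ≤
      ∑ E ∈ univ.filter (fun E : CSSPhenom.History (Fin (i + 1 + 1) × Fin (i + 1 - 1)) (Fin (i + 1) × Fin (i + 1)) (T i) =>
        ∑ j : Fin (i + 1), CSSPhenom.proj (D i (CSSPhenom.stSyn (HX (i + 1)) (T i) E) + E) (j, ⟨0, by omega⟩) = 1),
        phenomenologicalWeight (T i) p p (supp E) := by
  refine Finset.sum_le_sum_of_subset_of_nonneg (fun E hE => ?_) fun E _ _ => ?_
  · rw [Finset.mem_filter] at hE ⊢
    exact ⟨Finset.mem_univ _, rsc_phenom_oddResidual_of_not_corrects (by omega) (T i) (hD i) hE.2⟩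
  · rw [ToricCode.phenomenologicalWeight_self]
    exact bernoulliWeight_nonneg hp0 hp1 _

/-- ★ **DKLP's finite-size bound for the rotated-surface-code memory experiment, proved**: under `cₙ(ℤ³) ≤ C νⁿ` (`ν > 0`), for
every minimum-weight space-time decoder family of the `H_X` sector, every `0 ≤ p ≤ 1/2` (`q = p`) with `r = 2ν√(p(1-p)) < 1`:
`P_fail(i) ≤ (i+1)·T(i)·C·r^{i+1}/(1-r)` (relative form of eq. (fail_iso) on the rotated cubic lattice, our constants).
[cite: DennisEtAl2002, §5.3 eq. (fail_iso)] -/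
theorem rsc_zPhenomFailureFamily_le_of_sawCountBound3 {C ν : ℝ} (hν : 0 < ν) (hC : SAWCountBound3 C ν) (T : ℕ → ℕ)
    (D : ∀ i, CSSPhenom.STDecoder (Fin (i + 1 + 1) × Fin (i + 1 - 1)) (Fin (i + 1) × Fin (i + 1)) (T i))
    (hD : ∀ i, (D i).IsMinWeight (CSSPhenom.stSyn (rscCode i).HX (T i)) (CSSPhenom.stCycles (rscCode i).HX (T i))
      hammingNorm)
    (i : ℕ) {p : ℝ} (hp0 : 0 ≤ p) (hp : p ≤ 1 / 2) (hr1 : 2 * ν * Real.sqrt (p * (1 - p)) < 1) :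
    zPhenomFailureFamily rscCode T D i p ≤ ((i + 1 : ℕ) : ℝ) * (T i) * C * (2 * ν * Real.sqrt (p * (1 - p))) ^ (i + 1) /
      (1 - 2 * ν * Real.sqrt (p * (1 - p))) :=
  (rsc_zPhenomFailureFamily_le_sum_oddResidual T D hD i hp0 (by linarith)).trans
    (rsc_st_sum_oddResidual_le (L := i + 1) (by omega) hν hC (hD i) hp0 hp hr1)

/-- **Below threshold for `4ν² p(1-p) < 1`** (given `cₙ(ℤ³) ≤ C νⁿ`, `ν > 0`, polynomially many rounds): the rotated
memory-experiment failure probability tends to `0`, for every minimum-weight space-time decoder family of the `H_X` sector.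
[cite: DennisEtAl2002, §5.3 eq. (threshold_iso)] -/
theorem rsc_z_phenom_belowThreshold_of_sawCountBound3 {C ν : ℝ} (hν : 0 < ν) (hC : SAWCountBound3 C ν) {T : ℕ → ℕ}
    (hT : IsPolyBounded T)
    (D : ∀ i, CSSPhenom.STDecoder (Fin (i + 1 + 1) × Fin (i + 1 - 1)) (Fin (i + 1) × Fin (i + 1)) (T i))
    (hD : ∀ i, (D i).IsMinWeight (CSSPhenom.stSyn (rscCode i).HX (T i)) (CSSPhenom.stCycles (rscCode i).HX (T i))
      hammingNorm)
    {p : ℝ} (hp0 : 0 ≤ p) (hp : p ≤ 1 / 2) (h4 : 4 * ν ^ 2 * (p * (1 - p)) < 1) :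
    BelowThreshold (zPhenomFailureFamily rscCode T D) p := by
  have ht := rsc_st_tendsto_sum_oddResidual hν hC hT D hD hp0 hp h4
  refine squeeze_zero' (Filter.Eventually.of_forall fun i => ?_)
    (Filter.Eventually.of_forall fun i => rsc_zPhenomFailureFamily_le_sum_oddResidual T D hD i hp0 (by linarith)) ht
  refine Finset.sum_nonneg fun E _ => ?_
  rw [ToricCode.phenomenologicalWeight_self]
  exact bernoulliWeight_nonneg hp0 (by linarith) _

/-! ### `p₀(ν)`, `p₀(μ')`, and the kernel certificate `μ(ℤ³) ≤ 4.7476`: `p_c^phenom(RSC) > .0112` -/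

/-- **Rotated phenomenological threshold `≥ p₀(ν)` from `cₙ(ℤ³) ≤ C νⁿ`** (`ν ≥ 1`), every polynomially bounded schedule and
minimum-weight space-time decoder family of the `H_X` sector. [cite: DennisEtAl2002, §5.3 eqs. (threshold_iso), (threshold_iso_num)] -/
theorem rsc_z_phenom_isThresholdLowerBound_of_sawCountBound3 {C ν : ℝ} (hν : 1 ≤ ν) (hC : SAWCountBound3 C ν)
    {T : ℕ → ℕ} (hT : IsPolyBounded T)
    (D : ∀ i, CSSPhenom.STDecoder (Fin (i + 1 + 1) × Fin (i + 1 - 1)) (Fin (i + 1) × Fin (i + 1)) (T i))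
    (hD : ∀ i, (D i).IsMinWeight (CSSPhenom.stSyn (rscCode i).HX (T i)) (CSSPhenom.stCycles (rscCode i).HX (T i))
      hammingNorm) :
    IsThresholdLowerBound (zPhenomFailureFamily rscCode T D) (thresholdValue ν) := by
  intro p hp₀ hpp
  have hp : p ≤ 1 / 2 := hpp.le.trans (thresholdValue_le_half ν)
  have hlt : p * (1 - p) < thresholdValue ν * (1 - thresholdValue ν) :=
    mul_one_sub_lt_mul_one_sub hpp (by linarith [thresholdValue_le_half ν])
  have hν0 : 0 < ν := lt_of_lt_of_le one_pos hν
  have h4 : 4 * ν ^ 2 * (p * (1 - p)) < 1 := by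
    calc 4 * ν ^ 2 * (p * (1 - p)) < 4 * ν ^ 2 * (thresholdValue ν * (1 - thresholdValue ν)) := by gcongr
      _ = 1 := four_mul_sq_mul_thresholdValue hν
  exact rsc_z_phenom_belowThreshold_of_sawCountBound3 hν0 hC hT D hD hp₀ hp h4

/-- **Rotated phenomenological threshold from any bound on `μ(ℤ³)`** (tier = that of the bound): if `μ(ℤ³) ≤ μ'`, `μ' ≥ 1`,
then `p₀(μ')` is a threshold lower bound (every polynomially bounded schedule, every minimum-weight space-time decoder family
of the `H_X` sector). [cite: DennisEtAl2002, §5.3 eqs. (saw_3), (threshold_iso)] -/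
theorem rsc_z_phenom_isThresholdLowerBound_of_connectiveConstant_three_le {μ' : ℝ} (hμ'1 : 1 ≤ μ')
    (hμ : SAW.Zd.connectiveConstant 3 ≤ μ') {T : ℕ → ℕ} (hT : IsPolyBounded T)
    (D : ∀ i, CSSPhenom.STDecoder (Fin (i + 1 + 1) × Fin (i + 1 - 1)) (Fin (i + 1) × Fin (i + 1)) (T i))
    (hD : ∀ i, (D i).IsMinWeight (CSSPhenom.stSyn (rscCode i).HX (T i)) (CSSPhenom.stCycles (rscCode i).HX (T i))
      hammingNorm) :
    IsThresholdLowerBound (zPhenomFailureFamily rscCode T D) (thresholdValue μ') := by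
  refine isThresholdLowerBound_thresholdValue_of_forall_gt hμ'1 fun ν hν p hp0 hp h4 => ?_
  obtain ⟨C, hC⟩ := exists_sawCountBound3_of_connectiveConstant_lt (lt_of_le_of_lt hμ hν)
  exact rsc_z_phenom_belowThreshold_of_sawCountBound3 (by linarith) hC hT D hD hp0 hp h4

/-- ★ **Rotated surface codes, noisy measurement, `H_X` sector: threshold `≥ p₀(4.7476)`, UNCONDITIONAL, tier CERTIFIED
(kernel)**: every polynomially bounded schedule of rounds, every minimum-weight space-time decoder family (`q = p`), from the
kernel-checked symmetry-reduced memory-12 bound `μ(ℤ³) ≤ 4.7476` (was `p₀(5)`, item 143).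
[cite: DennisEtAl2002, §5.3 eqs. (saw_3), (threshold_iso_num)] [cite: PonitzTittmann2000, Table 2 (d = 3, k = 12)] -/
theorem rsc_z_phenom_isThresholdLowerBound_kernelZ3SymmK12 {T : ℕ → ℕ} (hT : IsPolyBounded T)
    (D : ∀ i, CSSPhenom.STDecoder (Fin (i + 1 + 1) × Fin (i + 1 - 1)) (Fin (i + 1) × Fin (i + 1)) (T i))
    (hD : ∀ i, (D i).IsMinWeight (CSSPhenom.stSyn (rscCode i).HX (T i)) (CSSPhenom.stCycles (rscCode i).HX (T i))
      hammingNorm) :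
    IsThresholdLowerBound (zPhenomFailureFamily rscCode T D) (thresholdValue 4.7476) :=
  rsc_z_phenom_isThresholdLowerBound_of_connectiveConstant_three_le (by norm_num)
    SAW.Zd.FiniteMemory3.connectiveConstant_three_le_47476 hT D hD

/-- ★ **`p_c^phenom(RSC, H_X sector) > .0112`** (`q = p`, polynomially many rounds, every minimum-weight space-time decoder
family) — UNCONDITIONAL, tier CERTIFIED (kernel); was `.0101` (item 143). DKLP's printed `.0114` and the numerical `.0293`
(Wang–Harrington–Preskill) are CLAIMS, not asserted. [cite: DennisEtAl2002, §5.3 eq. (threshold_iso_num)]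
[cite: WangHarringtonPreskill2003, abstract (p_c0 = .0293 ± .0002, numerical)] -/
theorem rsc_z_phenom_accuracyThreshold_gt_0112 {T : ℕ → ℕ} (hT : IsPolyBounded T)
    (D : ∀ i, CSSPhenom.STDecoder (Fin (i + 1 + 1) × Fin (i + 1 - 1)) (Fin (i + 1) × Fin (i + 1)) (T i))
    (hD : ∀ i, (D i).IsMinWeight (CSSPhenom.stSyn (rscCode i).HX (T i)) (CSSPhenom.stCycles (rscCode i).HX (T i))
      hammingNorm) :
    (0.0112 : ℝ) < accuracyThreshold (zPhenomFailureFamily rscCode T D) :=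
  lt_of_lt_of_le thresholdValue_47476_bounds.1
    (le_accuracyThreshold (rsc_z_phenom_isThresholdLowerBound_kernelZ3SymmK12 hT D hD)
      ((thresholdValue_le_half _).trans (by norm_num)))

/-- The canonical instance: MINIMUM-WEIGHT SPACE-TIME DECODING of the rotated memory experiment has `p_c > .0112` —
UNCONDITIONAL, tier CERTIFIED (kernel). [cite: DennisEtAl2002, §5.1 eq. (E_min) and §5.3] -/
theorem rsc_z_phenom_accuracyThreshold_stMinWeight_gt_0112 {T : ℕ → ℕ} (hT : IsPolyBounded T) :
    (0.0112 : ℝ) < accuracyThreshold (zPhenomFailureFamily rscCode T fun i =>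
      Decoder.minWeight (CSSPhenom.stSyn (rscCode i).HX (T i)) hammingNorm) :=
  rsc_z_phenom_accuracyThreshold_gt_0112 hT _ fun i =>
    Decoder.isMinWeight_minWeight _ _ _
      (fun y z h => by
        show CSSPhenom.stMatrix (rscCode i).HX (T i) *ᵥ (y - z) = 0
        have h' : CSSPhenom.stMatrix (rscCode i).HX (T i) *ᵥ y = CSSPhenom.stMatrix (rscCode i).HX (T i) *ᵥ z := h
        rw [Matrix.mulVec_sub, h', sub_self])
      fun x => by rw [show -x = x from funext fun i => ZMod.neg_eq_self_mod_two (x i)]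

/-- **Exponential decay below `p₀(ν)`** (given `cₙ(ℤ³) ≤ C νⁿ`, `ν ≥ 1`, polynomially many rounds): for every minimum-weight
space-time decoder family of the `H_X` sector and every `0 ≤ p < p₀(ν)` (`q = p`), `P_fail(i) ≤ C' r'^i` for some `C'`,
`r' < 1` (from `(i+1)·T(i)·C·r^{i+1}/(1-r) ≤ (ACr/(1-r))·(i+1)^{m+1}·r^i` when `T(i) ≤ A (i+1)^m`).
[cite: DennisEtAl2002, §5.3 eq. (fail_iso) and the sentence after it] -/
theorem rsc_z_phenom_decaysExponentially_of_sawCountBound3 {C ν : ℝ} (hν : 1 ≤ ν) (hC : SAWCountBound3 C ν)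
    {T : ℕ → ℕ} (hT : IsPolyBounded T)
    (D : ∀ i, CSSPhenom.STDecoder (Fin (i + 1 + 1) × Fin (i + 1 - 1)) (Fin (i + 1) × Fin (i + 1)) (T i))
    (hD : ∀ i, (D i).IsMinWeight (CSSPhenom.stSyn (rscCode i).HX (T i)) (CSSPhenom.stCycles (rscCode i).HX (T i))
      hammingNorm)
    {p : ℝ} (hp₀ : 0 ≤ p) (hpp : p < thresholdValue ν) : DecaysExponentially (zPhenomFailureFamily rscCode T D) p := by
  have hp : p ≤ 1 / 2 := hpp.le.trans (thresholdValue_le_half ν)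
  have hlt : p * (1 - p) < thresholdValue ν * (1 - thresholdValue ν) :=
    mul_one_sub_lt_mul_one_sub hpp (by linarith [thresholdValue_le_half ν])
  have hν0 : 0 < ν := lt_of_lt_of_le one_pos hν
  have h4 : 4 * ν ^ 2 * (p * (1 - p)) < 1 := by
    calc 4 * ν ^ 2 * (p * (1 - p)) < 4 * ν ^ 2 * (thresholdValue ν * (1 - thresholdValue ν)) := by gcongr
      _ = 1 := four_mul_sq_mul_thresholdValue hν
  set s := Real.sqrt (p * (1 - p)) with hs
  set r := 2 * ν * s with hr
  have hpp' : 0 ≤ p * (1 - p) := mul_nonneg hp₀ (by linarith)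
  have hr0 : 0 ≤ r := by rw [hr]; positivity
  have hr1 : r < 1 := by
    have hsq : r ^ 2 = 4 * ν ^ 2 * (p * (1 - p)) := by
      rw [hr, mul_pow, mul_pow, hs, Real.sq_sqrt hpp']; ring
    have h' : r ^ 2 < 1 := by rw [hsq]; exact h4
    have := (sq_lt_one_iff_abs_lt_one r).1 h'
    rwa [abs_of_nonneg hr0] at this
  have h1r : 0 < 1 - r := by linarith
  have hC0 : 0 ≤ C := by
    have h0 := hC 0
    rw [SAW.Zd.count_zero, pow_zero, mul_one, Nat.cast_one] at h0
    linarith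
  obtain ⟨A, m, hA⟩ := hT
  refine decaysExponentially_of_eventually_abs_le (A := A * C * r / (1 - r)) (k := m + 1) hr0 hr1 ?_
  refine Filter.Eventually.of_forall fun i => ?_
  have hnonneg : 0 ≤ zPhenomFailureFamily rscCode T D i p := by
    refine Finset.sum_nonneg fun E _ => ?_
    rw [ToricCode.phenomenologicalWeight_self]
    exact bernoulliWeight_nonneg hp₀ (by linarith) _
  rw [abs_of_nonneg hnonneg]
  have hb := rsc_zPhenomFailureFamily_le_of_sawCountBound3 hν0 hC T D hD i hp₀ hp hr1
  have hk : (0 : ℝ) ≤ ((i + 1 : ℕ) : ℝ) := by positivity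
  have hX : 0 ≤ A * ((i : ℝ) + 1) ^ m := (Nat.cast_nonneg (T i)).trans (hA i)
  calc zPhenomFailureFamily rscCode T D i p
      ≤ ((i + 1 : ℕ) : ℝ) * (T i) * C * r ^ (i + 1) / (1 - r) := hb
    _ ≤ ((i + 1 : ℕ) : ℝ) * (A * ((i : ℝ) + 1) ^ m) * C * r ^ (i + 1) / (1 - r) :=
        div_le_div_of_nonneg_right
          (mul_le_mul_of_nonneg_right (mul_le_mul_of_nonneg_right (mul_le_mul_of_nonneg_left (hA i) hk) hC0)
            (pow_nonneg hr0 _)) h1r.le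
    _ = A * C * r / (1 - r) * ((i : ℝ) + 1) ^ (m + 1) * r ^ i := by
        push_cast
        rw [pow_succ, pow_succ]
        ring

/-- **Exponential decay at every `0 ≤ p ≤ .0112`** for the rotated memory experiment (`q = p`, polynomially many rounds, every
minimum-weight space-time decoder family of the `H_X` sector) — UNCONDITIONAL, tier CERTIFIED (kernel) (cubic walk-count
constant at `ν = 4.75 > μ(ℤ³)`; `.0112 < p₀(4.75)`). [cite: DennisEtAl2002, §5.3 eq. (fail_iso)] -/
theorem rsc_z_phenom_decaysExponentially_0112 {T : ℕ → ℕ} (hT : IsPolyBounded T)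
    (D : ∀ i, CSSPhenom.STDecoder (Fin (i + 1 + 1) × Fin (i + 1 - 1)) (Fin (i + 1) × Fin (i + 1)) (T i))
    (hD : ∀ i, (D i).IsMinWeight (CSSPhenom.stSyn (rscCode i).HX (T i)) (CSSPhenom.stCycles (rscCode i).HX (T i))
      hammingNorm)
    {p : ℝ} (hp₀ : 0 ≤ p) (hpp : p ≤ 0.0112) : DecaysExponentially (zPhenomFailureFamily rscCode T D) p := by
  have hlt : SAW.Zd.connectiveConstant 3 < 4.75 :=
    lt_of_le_of_lt SAW.Zd.FiniteMemory3.connectiveConstant_three_le_47476 (by norm_num)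
  obtain ⟨C, hC⟩ := exists_sawCountBound3_of_connectiveConstant_lt hlt
  have hval : (0.0112 : ℝ) < thresholdValue 4.75 := by
    unfold thresholdValue
    have : Real.sqrt (1 - 1 / (4.75 : ℝ) ^ 2) < 0.9776 := by
      rw [Real.sqrt_lt' (by norm_num)]
      norm_num
    linarith
  exact rsc_z_phenom_decaysExponentially_of_sawCountBound3 (by norm_num) hC hT D hD hp₀ (lt_of_le_of_lt hpp hval)

/-! ### Space-time minimum-weight perfect matching with the rough edge as boundary -/

/-- ★ **Rotated phenomenological threshold `≥ p₀(4.7476)` for EVERY space-time boundary-MWPM decoder family** (defects =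
syndrome changes of the `T(i)` rounds matched in the space-time graph with the boundary vertex; any graphlike-with-boundary
presentation `ι i` of `HX (i+1)` — they exist, `card_colSupp_HX_le` — any link metric on the space-time lift, tie-break,
geodesics) — UNCONDITIONAL, tier CERTIFIED (kernel). [cite: DennisEtAl2002, §5.1 (E_min on the space-time lattice by matching) and §5.3] -/
theorem rsc_z_phenom_mwpm_isThresholdLowerBound_kernelZ3SymmK12 {T : ℕ → ℕ} (hT : IsPolyBounded T)
    {ι : ∀ i, Fin (i + 1) × Fin (i + 1) → Sym2 (Option (Fin (i + 1 + 1) × Fin (i + 1 - 1)))}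
    (hι : ∀ i, IsGraphlikeVia (rscCode i).HX (ι i)) (m : ∀ i, EdgeMetric (stEndsOf (ι i) (T i)))
    {D' : ∀ i, Decoder (Option ((Fin (i + 1 + 1) × Fin (i + 1 - 1)) × Fin (T i + 1)) → ZMod 2)
      (HistoryLoc (Fin (i + 1) × Fin (i + 1)) (Fin (i + 1 + 1) × Fin (i + 1 - 1)) (T i) → ZMod 2)}
    (hD : ∀ i, IsMatchingDecoder (m i) (D' i)) :
    IsThresholdLowerBound (zPhenomFailureFamily rscCode T fun i => boundaryDecoder (D' i)) (thresholdValue 4.7476) :=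
  rsc_z_phenom_isThresholdLowerBound_kernelZ3SymmK12 hT _ fun i => isMinWeight_boundaryDecoder_st (hι i) (T i) (hD i)

/-- **`p_c^{MWPM, phenom}(RSC, H_X sector) > .0112`**, every space-time boundary-MWPM family — UNCONDITIONAL, tier CERTIFIED
(kernel); was `.0101`. [cite: DennisEtAl2002, §5.1 and §5.3 eq. (threshold_iso_num)] -/
theorem rsc_z_phenom_mwpm_accuracyThreshold_gt_0112 {T : ℕ → ℕ} (hT : IsPolyBounded T)
    {ι : ∀ i, Fin (i + 1) × Fin (i + 1) → Sym2 (Option (Fin (i + 1 + 1) × Fin (i + 1 - 1)))}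
    (hι : ∀ i, IsGraphlikeVia (rscCode i).HX (ι i)) (m : ∀ i, EdgeMetric (stEndsOf (ι i) (T i)))
    {D' : ∀ i, Decoder (Option ((Fin (i + 1 + 1) × Fin (i + 1 - 1)) × Fin (T i + 1)) → ZMod 2)
      (HistoryLoc (Fin (i + 1) × Fin (i + 1)) (Fin (i + 1 + 1) × Fin (i + 1 - 1)) (T i) → ZMod 2)}
    (hD : ∀ i, IsMatchingDecoder (m i) (D' i)) :
    (0.0112 : ℝ) < accuracyThreshold (zPhenomFailureFamily rscCode T fun i => boundaryDecoder (D' i)) :=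
  rsc_z_phenom_accuracyThreshold_gt_0112 hT _ fun i => isMinWeight_boundaryDecoder_st (hι i) (T i) (hD i)

/-- **The `H_X`-sector memory experiment of the rotated surface codes is below threshold at every `p < .0112`** for every
minimum-weight space-time decoder family and every polynomially bounded schedule (`q = p`) — UNCONDITIONAL, tier CERTIFIED
(kernel). [cite: DennisEtAl2002, §5.3 eq. (threshold_iso_num)] -/
theorem rsc_z_phenom_belowThreshold_0112 {T : ℕ → ℕ} (hT : IsPolyBounded T)
    (D : ∀ i, CSSPhenom.STDecoder (Fin (i + 1 + 1) × Fin (i + 1 - 1)) (Fin (i + 1) × Fin (i + 1)) (T i))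
    (hD : ∀ i, (D i).IsMinWeight (CSSPhenom.stSyn (rscCode i).HX (T i)) (CSSPhenom.stCycles (rscCode i).HX (T i))
      hammingNorm) {p : ℝ} (hp₀ : 0 ≤ p) (hpp : p < 0.0112) :
    BelowThreshold (zPhenomFailureFamily rscCode T D) p :=
  (rsc_z_phenom_isThresholdLowerBound_kernelZ3SymmK12 hT D hD).anti thresholdValue_47476_bounds.1.le p hp₀ hpp

end Summit.Ventures.QEC.Thresholds
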